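import Summits.Ventures.QEC.Census.CertChunks
import Summits.Ventures.QEC.Census.CertBZInfoSets
import HarnessLib

/-!
# `scan = true` from chunks (the converse of `scan_sublist`), and chunked `bz` enumeration verdicts

`Census/CertScan.lean` proves `scan … = true → Reaches …` and `Census/CertChunks.lean` assembles `Reaches` from
first-position chunks. The `bz` block check of `Census/CertCheckBZ.lean`, however, consumes the BOOLEAN
`scan (bzLeaf …) (rowPos G_i 0) t 0 0 = true` (inside `matrixOK`), and one such scan for `[[144,12,12]]`
(`1.5 · 10⁷` codewords at depth `5`) exceeds the gate's per-certificate `native_decide` budget (qec-search-7, p472445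
PENDING-CERT) and the kernel's deterministic budget. This file closes the loop:

* `scan_eq_true_of_reaches` — `Reaches test L b v s → scan test L b v s = true` (every leaf of the scan is the test
  at some sub-list), so the Bool verdict can be ASSEMBLED from chunk verdicts;
* `scan_origin_eq_true_of_chunk1` — first-position chunks (`CertChunks.chunk1`/`chunk1R`) ⇒ `scan test L (b+1) 0 0`;
* `bzTestZ`/`bzPosZ`/`bzDepthZ` (+`X`) — short names for the test, position list and depth of matrix `i` of block
  `b` of a `BZData`, with `bzZEnum_of_scan` : `scan (bzTestZ c z) (bzPosZ c z b i) (bzDepthZ z b i) 0 0 = true →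
  c.bzZEnum z b i = true` — so an emitted certificate proves each enumeration verdict from a handful of
  `chunk1R … = true` facts, each small enough for one `native_decide` (or `decide +kernel`).

Generic; no `decide` here; axioms ⊆ {propext, Classical.choice, Quot.sound}.
-/

namespace Summit.Ventures.QEC.Census

open Literature.InformationTheory.QuantumCodes

section Converse

variable {test : ℕ → ℕ → Bool}

/-- **The converse of `scan_sublist`**: if `test` holds at every sub-list end point, the scan passes. -/
theorem scan_eq_true_of_reaches : ∀ (L : List (ℕ × ℕ)) (b v s : ℕ), Reaches test L b v s → scan test L b v s = true := by
  intro L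
  induction L with
  | nil =>
    intro b v s h
    have := h [] List.Sublist.slnil (Nat.zero_le _)
    simpa [scan, xorFst, xorSnd, xorList] using this
  | cons p rest ih =>
    intro b v s h
    cases b with
    | zero =>
      have := h [] (List.nil_sublist _) (le_refl 0)
      obtain ⟨p1, p2⟩ := p
      simpa [scan, xorFst, xorSnd, xorList] using this
    | succ b =>
      obtain ⟨p1, p2⟩ := p
      rw [scan, Bool.and_eq_true]
      refine ⟨ih (b + 1) v s fun S hS hlen => h S (hS.cons _) hlen, ih b (v ^^^ p1) (s ^^^ p2) fun S hS hlen => ?_⟩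
      have := h ((p1, p2) :: S) (hS.cons_cons _) (by simpa using hlen)
      rw [xorFst_cons, xorSnd_cons, ← Nat.xor_assoc, ← Nat.xor_assoc] at this
      exact this

/-- **A scan from the origin, from first-position chunks**: `test 0 0` and, for every position `i < |L|`,
`Reaches` over the later positions started at position `i` (e.g. from `chunk1_sound` / `forall_of_chunk1R`)
give `scan test L (b + 1) 0 0 = true`. The length is taken as a numeral `n`. -/
theorem scan_origin_eq_true_of_chunk1 {L : List (ℕ × ℕ)} {b : ℕ} (n : ℕ) (hn : L.length = n) (h0 : test 0 0 = true)
    (h : ∀ i, i < n → Reaches test (L.drop (i + 1)) b (L.getD i (0, 0)).1 (L.getD i (0, 0)).2) :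
    scan test L (b + 1) 0 0 = true :=
  scan_eq_true_of_reaches L (b + 1) 0 0 (reaches_origin_of_chunk1 n hn h0 h)

end Converse

/-! ## Short names for the `bz` enumeration of one matrix, and the verdict from a scan -/

namespace DistCert

variable (c : DistCert) (z : BZData)

/-- The leaf test of the `Z`-side `bz` enumeration: `bzLeaf (dZ − 1) allow`. -/
def bzTestZ : ℕ → ℕ → Bool := bzLeaf (c.dZ - 1) (c.sideZ.found.map Prod.fst)

/-- The position list `(2^j, G_i[j])` of matrix `i` of block `b`, `Z` side (`[]` past the end). -/
def bzPosZ (b i : ℕ) : List (ℕ × ℕ) :=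
  match z.sideZ.blocks[b]? with
  | none => []
  | some blk =>
    match blk.mats[i]? with
    | none => []
    | some mt => rowPos (giRows (gbRows c.HZ z.rcZ z.LZ blk) mt) 0

/-- The enumeration depth `t_i` of matrix `i` of block `b`, `Z` side (`0` past the end). -/
def bzDepthZ (b i : ℕ) : ℕ :=
  match z.sideZ.blocks[b]? with
  | none => 0
  | some blk =>
    match blk.mats[i]? with
    | none => 0
    | some mt => mt.t

/-- The leaf test of the `X`-side `bz` enumeration. -/
def bzTestX : ℕ → ℕ → Bool := bzLeaf (c.dX - 1) (c.sideX.found.map Prod.fst)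

/-- The position list of matrix `i` of block `b`, `X` side. -/
def bzPosX (b i : ℕ) : List (ℕ × ℕ) :=
  match z.sideX.blocks[b]? with
  | none => []
  | some blk =>
    match blk.mats[i]? with
    | none => []
    | some mt => rowPos (giRows (gbRows c.HX z.rcX z.LX blk) mt) 0

/-- The enumeration depth of matrix `i` of block `b`, `X` side. -/
def bzDepthX (b i : ℕ) : ℕ :=
  match z.sideX.blocks[b]? with
  | none => 0
  | some blk =>
    match blk.mats[i]? with
    | none => 0
    | some mt => mt.t

/-- **The `Z`-side enumeration verdict from its scan** (stated with the short names; any tier). -/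
theorem bzZEnum_of_scan (b i : ℕ) (h : scan (c.bzTestZ) (c.bzPosZ z b i) (bzDepthZ z b i) 0 0 = true) :
    c.bzZEnum z b i = true := by
  unfold bzZEnum
  unfold bzPosZ bzDepthZ at h
  split
  · rfl
  · rename_i blk hb
    rw [hb] at h
    dsimp only at h
    split
    · rfl
    · rename_i mt hm
      rw [hm] at h
      dsimp only at h
      exact h

/-- **The `X`-side enumeration verdict from its scan.** -/
theorem bzXEnum_of_scan (b i : ℕ) (h : scan (c.bzTestX) (c.bzPosX z b i) (bzDepthX z b i) 0 0 = true) :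
    c.bzXEnum z b i = true := by
  unfold bzXEnum
  unfold bzPosX bzDepthX at h
  split
  · rfl
  · rename_i blk hb
    rw [hb] at h
    dsimp only at h
    split
    · rfl
    · rename_i mt hm
      rw [hm] at h
      dsimp only at h
      exact h

end DistCert

end Summit.Ventures.QEC.Census
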